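import Summits.Ventures.CertifiedManyBodySolver.Downfold.EmeryOrbitalWeightHarmonic
import HarnessLib

/-!
# THE HOPPING-RANGE LAW OF THE 3 → 1 REDUCTION AT THE FERMI SURFACE: a `t–t′` (range-1) one-band form carries the σ contour EXACTLY and its
# Fermi velocity up to the anisotropy `φ = D_max/D_min` (complete misfit, affine in the harmonic; no choice of `t` does better than
# `(φ − 1)/(φ + 1)` uniformly); a range-2 form (`t, t′, t″, t‴, t⁗`, explicit) carries contour AND velocity with relative misfit
# `0 ≤ e(s) = 64β²(s − s₁)(s₂ − s)/(D₁D₂) ≤ (φ − 1)²/(4φ)`; individual longer-range hoppings are NOT Fermi-surface observables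

Venture CertifiedManyBodySolver, cell `pub/hubbard-downfold` (stage S1; INFLATION-RULES-3to1-B §B.76 — the band-level reduction error of the
σ three-band (Emery) model BY HOPPING RANGE), seat hubbard-downfold-mod-4 (technique B, g31); namespace
`Summit.Ventures.CertifiedManyBodySolver.Downfold.Emery`. Sequel of `EmeryFermiSurfaceShape` (every contour is a `t–t′` contour),
`EmeryFermiSurfaceShapeBox` §2 (`dcharCubic`, `charCubic_taylor`, `scaleT = fsT/∂_ε charCubic`) and `EmeryFermiScaleHarmonic` (§B.75:
`fsT·∂_ε charCubic = α + 8β·s` on the contour, `s = (1 − cos k_x cos k_y)/2`). Everything PROVED (0 sorry; `ring`/`field_simp` identities and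
elementary inequalities). WHAT THIS IS NOT: a statement about any material; correlated renormalisation; `U = 0` one-body kinematics of the σ model
as printed; the «range-2 form» is the velocity-matched representative, not a Wannier (object M) fit.

* §1 THE UNIT FORM AND THE ENERGY-LINEARISED BAND. `fsQ = 4fsD·(x + y) + 16fsN·xy` is the `k`-dependent part of the secular cubic
  (`charCubic = cA − fsQ`; in cosines `fsQ = 4(fsD + fsN) + oneBand5 fsT (−fsN) 0 0 0`, i.e. the `t–t′` dispersion with `(t, t′) = (fsT, −fsN)` in
  cubic units). The first Newton step of `charCubic(k, ε + h) = 0` is `linBand = (fsQ − cA)/∂_ε charCubic = scaleT·(fsQ − cA)/fsT`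
  (`linBand_eq_scaleT_mul`): to first order in the distance from the contour the σ band IS the unit `t–t′` form times the LOCAL scale `t_eff(k)`;
  the residual of the step is second order (`charCubic_at_linBand`).
* §2 ONE-BAND FORMS THROUGH THE CONTOUR. A one-band form vanishing on the contour, `G = (fsQ − cA)·M`, has first-order data `G = (M·∂_ε charCubic)·linBand`
  (`form_eq_relVel_mul_linBand`): its velocity relative to the σ band at the contour point is `relVel = M·∂_ε charCubic`, misfit `e = relVel − 1`, and ON
  THE CONTOUR `fsT·e = M·(α + 8β·s) − fsT` (`fsT_mul_misfit`) with `harmD s = α + 8β·s`.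
* §3 RANGE 1 (`M = m` constant = every `t–t′` form with the contour's shape): `fsT·(e(k₁) − e(k₂)) = 8mβ·(s₁ − s₂)` (`range1_misfit_sub`) — exact at two
  harmonics only if `β = 0` (`range1_beta_zero_of_exact₂`; conversely `β = 0` ⇒ `m = fsT/α` is exact everywhere, `range1_exact_of_beta_zero`); matched at
  `k₁` the misfit at `k₂` is `(D₂ − D₁)/D₁` (`range1_misfit_matched`); for EVERY `m`, `max(|e₁|, |e₂|) ≥ |D₂ − D₁|/(D₁ + D₂) = (φ − 1)/(φ + 1)`
  (`range1_misfit_lower_bound`). This is the COMPLETE band-level content of the «form ambiguity `[t_an, t_node]`» of §B.65.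
* §4 RANGE 2. The two-harmonic interpolant `M(s) = interpConst + interpSlope·s` of `fsT/harmD` at `s₁ ≠ s₂` (`interp_at₁/₂`) has
  `M(s)·harmD(s) − fsT = −64β²·fsT·(s − s₁)(s − s₂)/(D₁D₂)` (`range2_defect_eq`), so its relative misfit is `e(s) = 64β²(s − s₁)(s₂ − s)/(D₁D₂)`
  (`range2_misfit_on_contour`): `0 ≤ e ≤ 16β²(s₂ − s₁)²/(D₁D₂) = (D₂ − D₁)²/(4D₁D₂) = (φ − 1)²/(4φ)` on `[s₁, s₂]` (`range2_misfit_nonneg`, `range2_misfit_le`,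
  `misfitBound_eq`, `misfitBound_eq_phi`, `misfitBound_mono`), second order and below the range-1 floor whenever `φ < 4` (`range2_bound_lt_range1_bound`). IN COSINES
  (`range2Form_cos`) the form `(fsQ − cA)·(a + b·s)` is the five-hopping dispersion `oneBand5 t t′ t″ t‴ t⁗` with `t = fsT(a + b/4)`,
  `t′ = −(a + b/2)fsN + (b/8)(4(fsD + fsN) − cA)`, `t″ = b·fsN/4`, `t‴ = −b·fsT/8` (the `(2,1)` star), `t⁗ = b·fsN/8` (the `(2,2)` star): velocity matching
  generates the longer-range hoppings in the FIXED proportion `t″ = 2r·t‴`, `t⁗ = t″/2` (`range2_hopping_ratios`, `r = −fsN/fsT = t′/t` of the contour).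
* §5 FERMI-SURFACE INVISIBILITY. `(fsQ − cA)²` is itself a range-2 dispersion (`gaugeForm_cos`, explicit hoppings); adding `γ·(fsQ − cA)²` to any form through
  the contour changes NEITHER the contour NOR the first-order data there (`gauge_multiplier_on_contour`): the individual `t′, t″, t‴, t⁗` of a range-2 one-band set
  are not Fermi-surface observables — only the shape `r` and the velocity line `(a, b)` are.
* §6 QUADRATURE (ONE-NUMBER) LAW: for any finite family of contour points with weights `w`, `Σ wᵢ/t_eff(kᵢ) = (α·Σwᵢ + 8β·Σwᵢsᵢ)/fsT²` (`sum_inv_scaleT`):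
  every weighted HARMONIC MEAN of the velocity-matched `t` over Fermi points (e.g. any density-of-states quadrature) is the harmonic-law scale at the
  mean harmonic `s̄`, `fsT²/(α + 8β·s̄)` (`harmMean_scaleT_eq`).

Numbers (seat-side floats on typed rows, HOME/hubbard-downfold-mod-4/range-g31/explore/ex1.py): La₂CuO₄ (K) σ row at `x = 0.16` has `φ − 1 = 0.0089`
(census 0.0091 certified), range-2 bound `1.9·10⁻⁵`, interpolant `t″/t = +0.0011`, `t‴/t = −0.0022`; the largest-`φ` typed class (axial co-shift `a = 0.40`
on HgBa₂CuO₄) has `φ − 1 = 0.12`, range-2 bound `3.1·10⁻³`, `t″/t = −0.021`, `t‴/t = +0.025` — at the band level the σ Fermi surface needs NO `t″` beyond a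
few per cent; the `t″/t ≈ 0.1` of one-band Wannier sets (object M) is an axial-orbital / whole-band feature ([PavariniEtAl2001]: the axial model's one-band
hoppings are a power series in the range parameter `r`, `t″ = t′/2 + o(r)`), never a σ Fermi-surface one.

Sources: three-band model [HybertsenSchluterChristensen1989, Eq. (1)]; energy-linearised downfolding and the `t, t′, t″` language [AndersenEtAl1995, §6];
range parameter and `t″ = t′/2` series [PavariniEtAl2001, text after Eq. (3)]; [folklore] algebra.
-/

noncomputable section

namespace Summit.Ventures.CertifiedManyBodySolver.Downfold.Emery

open Real Set

/-! ## §1 The unit form and the energy-linearised band -/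

/-- The `k`-dependent part of the secular cubic at energy `ε`: `fsQ = 4fsD·(x + y) + 16fsN·xy` (so `charCubic = cA − fsQ`). [folklore] -/
def fsQ (Δ tpd tpp c x y ε : ℝ) : ℝ := 4 * fsD Δ tpd c ε * (x + y) + 16 * fsN tpd tpp c ε * (x * y)

/-- `charCubic = cA − fsQ`. [folklore] -/
theorem charCubic_eq_cA_sub_fsQ (Δ tpd tpp c x y ε : ℝ) : charCubic Δ tpd tpp c x y ε = cA Δ ε - fsQ Δ tpd tpp c x y ε := by
  rw [charCubic_bilinear]; unfold fsQ; ring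

/-- On a contour `fsQ = cA`. [folklore] -/
theorem fsQ_eq_cA_of_contour {Δ tpd tpp c x y ε : ℝ} (hP : charCubic Δ tpd tpp c x y ε = 0) : fsQ Δ tpd tpp c x y ε = cA Δ ε := by
  rw [charCubic_eq_cA_sub_fsQ] at hP; linarith

/-- The five-hopping square-lattice dispersion (no constant): `−2t(cos k_x + cos k_y) − 4t′cos k_x cos k_y − 2t″(cos 2k_x + cos 2k_y)
− 4t‴(cos 2k_x cos k_y + cos k_x cos 2k_y) − 4t⁗cos 2k_x cos 2k_y` — hoppings to `(1,0)`, `(1,1)`, `(2,0)`, `(2,1)`, `(2,2)`. [folklore] -/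
def oneBand5 (t t₁ t₂ t₃ t₄ kx ky : ℝ) : ℝ :=
  -2 * t * (cos kx + cos ky) - 4 * t₁ * (cos kx * cos ky) - 2 * t₂ * (cos (2 * kx) + cos (2 * ky))
    - 4 * t₃ * (cos (2 * kx) * cos ky + cos kx * cos (2 * ky)) - 4 * t₄ * (cos (2 * kx) * cos (2 * ky))

/-- `oneBand5` extends the tree's `t–t′–t″` form `oneBand` by the `(2,1)` and `(2,2)` stars. [folklore] -/
theorem oneBand5_eq_oneBand_add (t t₁ t₂ t₃ t₄ kx ky : ℝ) :
    oneBand5 t t₁ t₂ t₃ t₄ kx ky = oneBand 0 t t₁ t₂ kx ky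
      - 4 * t₃ * (cos (2 * kx) * cos ky + cos kx * cos (2 * ky)) - 4 * t₄ * (cos (2 * kx) * cos (2 * ky)) := by
  unfold oneBand5 oneBand; ring

/-- IN COSINES the unit form is the `t–t′` dispersion with `(t, t′) = (fsT, −fsN)` (cubic units): at `x = (1 − cos k_x)/2`, `y = (1 − cos k_y)/2`,
`fsQ = 4(fsD + fsN) + oneBand5 fsT (−fsN) 0 0 0`. [cite: AndersenEtAl1995, §6] -/
theorem fsQ_cos (Δ tpd tpp c ε kx ky : ℝ) :
    fsQ Δ tpd tpp c ((1 - cos kx) / 2) ((1 - cos ky) / 2) ε =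
      4 * (fsD Δ tpd c ε + fsN tpd tpp c ε) + oneBand5 (fsT Δ tpd tpp c ε) (-fsN tpd tpp c ε) 0 0 0 kx ky := by
  unfold fsQ oneBand5 fsT; ring

/-- THE ENERGY-LINEARISED σ BAND about `ε`: the first Newton step `h` of `charCubic(k, ε + h) = 0`, `linBand = (fsQ − cA)/∂_ε charCubic = −charCubic/∂_ε charCubic`.
[cite: AndersenEtAl1995, §6 (energy linearisation)] -/
def linBand (Δ tpd tpp c x y ε : ℝ) : ℝ := (fsQ Δ tpd tpp c x y ε - cA Δ ε) / dcharCubic Δ tpd tpp c x y ε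

/-- `linBand = −charCubic/∂_ε charCubic`. [folklore] -/
theorem linBand_eq_neg_div (Δ tpd tpp c x y ε : ℝ) :
    linBand Δ tpd tpp c x y ε = -charCubic Δ tpd tpp c x y ε / dcharCubic Δ tpd tpp c x y ε := by
  unfold linBand; rw [charCubic_eq_cA_sub_fsQ]; ring

/-- **The linearised band is the LOCAL SCALE times the UNIT `t–t′` FORM**: `linBand(k) = scaleT(k)·(fsQ(k) − cA)/fsT` (`fsT ≠ 0`). [folklore] -/
theorem linBand_eq_scaleT_mul {Δ tpd tpp c x y ε : ℝ} (hT : fsT Δ tpd tpp c ε ≠ 0) :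
    linBand Δ tpd tpp c x y ε = scaleT Δ tpd tpp c x y ε * ((fsQ Δ tpd tpp c x y ε - cA Δ ε) / fsT Δ tpd tpp c ε) := by
  unfold linBand scaleT
  rw [div_mul_div_comm, mul_comm (fsT Δ tpd tpp c ε), mul_div_mul_right _ _ hT]

/-- The Newton step solves the secular equation to FIRST order: `charCubic(k, ε + linBand) = linBand²·(3ε + 2Δ + 4t_pp′(x + y)) + linBand³` (`∂_ε charCubic ≠ 0`).
[folklore] -/
theorem charCubic_at_linBand {Δ tpd tpp c x y ε : ℝ} (hW : dcharCubic Δ tpd tpp c x y ε ≠ 0) :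
    charCubic Δ tpd tpp c x y (ε + linBand Δ tpd tpp c x y ε) =
      linBand Δ tpd tpp c x y ε ^ 2 * (3 * ε + 2 * Δ + 4 * c * (x + y)) + linBand Δ tpd tpp c x y ε ^ 3 := by
  rw [charCubic_taylor]
  have h : charCubic Δ tpd tpp c x y ε + linBand Δ tpd tpp c x y ε * dcharCubic Δ tpd tpp c x y ε = 0 := by
    rw [linBand_eq_neg_div, div_mul_cancel₀ _ hW]; ring
  linarith

/-! ## §2 One-band forms through the contour: relative velocity and misfit -/

/-- The energy denominator at harmonic `s`: `harmD s = α + 8β·s` (`= fsT·∂_ε charCubic` at a contour point with `s(k) = s`). [folklore] -/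
def harmD (Δ tpd tpp c ε s : ℝ) : ℝ := scaleAlpha Δ tpd tpp c ε + 8 * scaleBeta Δ tpd tpp c ε * s

/-- On a contour `fsT·∂_ε charCubic(k) = harmD(s(k))`. [folklore] -/
theorem fsT_mul_dcharCubic_eq_harmD {Δ tpd tpp c x y ε : ℝ} (hP : charCubic Δ tpd tpp c x y ε = 0) :
    fsT Δ tpd tpp c ε * dcharCubic Δ tpd tpp c x y ε = harmD Δ tpd tpp c ε (tpHarm x y) :=
  fsT_mul_dcharCubic_of_contour hP

/-- Two energy denominators differ by `8β·(s₂ − s₁)`. [folklore] -/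
theorem harmD_sub (Δ tpd tpp c ε s₁ s₂ : ℝ) :
    harmD Δ tpd tpp c ε s₂ - harmD Δ tpd tpp c ε s₁ = 8 * scaleBeta Δ tpd tpp c ε * (s₂ - s₁) := by
  unfold harmD; ring

/-- A one-band form vanishing on the contour, `G = (fsQ − cA)·M`, has first-order data `G = (M·∂_ε charCubic)·linBand`: its velocity at the contour point
RELATIVE to the σ band is `M·∂_ε charCubic` (`∂_ε charCubic ≠ 0`). [folklore] -/
theorem form_eq_relVel_mul_linBand {Δ tpd tpp c x y ε : ℝ} (M : ℝ) (hW : dcharCubic Δ tpd tpp c x y ε ≠ 0) :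
    (fsQ Δ tpd tpp c x y ε - cA Δ ε) * M = (M * dcharCubic Δ tpd tpp c x y ε) * linBand Δ tpd tpp c x y ε := by
  unfold linBand
  rw [mul_assoc, mul_div_cancel₀ _ hW, mul_comm]

/-- ON THE CONTOUR the velocity misfit `e = M·∂_ε charCubic − 1` satisfies `fsT·e = M·harmD(s) − fsT`. [folklore] -/
theorem fsT_mul_misfit {Δ tpd tpp c x y ε : ℝ} (M : ℝ) (hP : charCubic Δ tpd tpp c x y ε = 0) :
    fsT Δ tpd tpp c ε * (M * dcharCubic Δ tpd tpp c x y ε - 1) = M * harmD Δ tpd tpp c ε (tpHarm x y) - fsT Δ tpd tpp c ε := by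
  rw [mul_sub, mul_one, ← mul_assoc, mul_comm (fsT Δ tpd tpp c ε) M, mul_assoc, fsT_mul_dcharCubic_eq_harmD hP]

/-! ## §3 Range 1: the `t–t′` forms — misfit affine in the harmonic -/

/-- **RANGE-1 MISFIT IS AFFINE IN THE HARMONIC**: for a constant multiplier `m` (a `t–t′` form with the contour's shape) at two contour points,
`fsT·(e₁ − e₂) = 8mβ·(s₁ − s₂)`. [folklore] -/
theorem range1_misfit_sub {Δ tpd tpp c x₁ y₁ x₂ y₂ ε : ℝ} (m : ℝ) (hP₁ : charCubic Δ tpd tpp c x₁ y₁ ε = 0) (hP₂ : charCubic Δ tpd tpp c x₂ y₂ ε = 0) :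
    fsT Δ tpd tpp c ε * ((m * dcharCubic Δ tpd tpp c x₁ y₁ ε - 1) - (m * dcharCubic Δ tpd tpp c x₂ y₂ ε - 1)) =
      8 * m * scaleBeta Δ tpd tpp c ε * (tpHarm x₁ y₁ - tpHarm x₂ y₂) := by
  rw [mul_sub (fsT Δ tpd tpp c ε), fsT_mul_misfit m hP₁, fsT_mul_misfit m hP₂]
  unfold harmD; ring

/-- A `t–t′` form velocity-exact at TWO contour points with different harmonics forces `β = 0` (`fsT ≠ 0`, `m ≠ 0`). [folklore] -/
theorem range1_beta_zero_of_exact₂ {Δ tpd tpp c x₁ y₁ x₂ y₂ ε m : ℝ} (hP₁ : charCubic Δ tpd tpp c x₁ y₁ ε = 0) (hP₂ : charCubic Δ tpd tpp c x₂ y₂ ε = 0)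
    (hm : m ≠ 0) (hs : tpHarm x₁ y₁ ≠ tpHarm x₂ y₂) (h₁ : m * dcharCubic Δ tpd tpp c x₁ y₁ ε = 1) (h₂ : m * dcharCubic Δ tpd tpp c x₂ y₂ ε = 1) :
    scaleBeta Δ tpd tpp c ε = 0 := by
  have h := range1_misfit_sub m hP₁ hP₂
  rw [h₁, h₂] at h
  norm_num at h
  rcases h with (h | h) | h
  · exact absurd h hm
  · exact h
  · exact absurd (sub_eq_zero.1 h) hs

/-- Conversely `β = 0` ⇒ the `t–t′` form with `m = fsT/α` is velocity-exact at EVERY contour point (`α ≠ 0`). [folklore] -/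
theorem range1_exact_of_beta_zero {Δ tpd tpp c x y ε : ℝ} (hP : charCubic Δ tpd tpp c x y ε = 0)
    (hα : scaleAlpha Δ tpd tpp c ε ≠ 0) (hβ : scaleBeta Δ tpd tpp c ε = 0) :
    fsT Δ tpd tpp c ε / scaleAlpha Δ tpd tpp c ε * dcharCubic Δ tpd tpp c x y ε = 1 := by
  have h := fsT_mul_dcharCubic_eq_harmD hP
  unfold harmD at h
  rw [hβ, mul_zero, zero_mul, add_zero] at h
  rw [div_mul_eq_mul_div, h, div_self hα]

/-- MATCHED AT ONE POINT: the `t–t′` form with `m = 1/∂_ε charCubic(k₁)` (velocity-exact at `k₁`, i.e. `t = t_eff(k₁)`) has misfit `(D₂ − D₁)/D₁ = 8β(s₂ − s₁)/D₁` at `k₂`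
(`Dᵢ = harmD(sᵢ)`, `fsT ≠ 0`, `D₁ ≠ 0`). [folklore] -/
theorem range1_misfit_matched {Δ tpd tpp c x₁ y₁ x₂ y₂ ε : ℝ} (hP₁ : charCubic Δ tpd tpp c x₁ y₁ ε = 0) (hP₂ : charCubic Δ tpd tpp c x₂ y₂ ε = 0)
    (hT : fsT Δ tpd tpp c ε ≠ 0) (hD₁ : harmD Δ tpd tpp c ε (tpHarm x₁ y₁) ≠ 0) :
    (dcharCubic Δ tpd tpp c x₁ y₁ ε)⁻¹ * dcharCubic Δ tpd tpp c x₂ y₂ ε - 1 =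
      (harmD Δ tpd tpp c ε (tpHarm x₂ y₂) - harmD Δ tpd tpp c ε (tpHarm x₁ y₁)) / harmD Δ tpd tpp c ε (tpHarm x₁ y₁) := by
  have h₁ := fsT_mul_dcharCubic_eq_harmD hP₁
  have h₂ := fsT_mul_dcharCubic_eq_harmD hP₂
  have e₁ : dcharCubic Δ tpd tpp c x₁ y₁ ε = harmD Δ tpd tpp c ε (tpHarm x₁ y₁) / fsT Δ tpd tpp c ε := by rw [eq_div_iff hT, mul_comm]; exact h₁
  have e₂ : dcharCubic Δ tpd tpp c x₂ y₂ ε = harmD Δ tpd tpp c ε (tpHarm x₂ y₂) / fsT Δ tpd tpp c ε := by rw [eq_div_iff hT, mul_comm]; exact h₂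
  rw [e₁, e₂]
  field_simp

/-- Helper: `|u − v| ≤ v|a| + u|b|` whenever `v(1 + a) = u(1 + b)`, `u, v ≥ 0`. [folklore] -/
theorem abs_sub_le_of_cross {u v a b : ℝ} (hu : 0 ≤ u) (hv : 0 ≤ v) (h : v * (1 + a) = u * (1 + b)) : |u - v| ≤ v * |a| + u * |b| := by
  have e : u - v = v * a - u * b := by linarith
  rw [e]
  calc |v * a - u * b| ≤ |v * a| + |u * b| := abs_sub _ _
    _ = v * |a| + u * |b| := by rw [abs_mul, abs_mul, abs_of_nonneg hv, abs_of_nonneg hu]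

/-- **THE RANGE-1 FLOOR**: for EVERY `t–t′` form (every `m`) the two misfits `eᵢ = m·Dᵢ/fsT − 1` at contour points with denominators `D₁, D₂ > 0` satisfy
`max(|e₁|, |e₂|) ≥ |D₂ − D₁|/(D₁ + D₂)` (`= (φ − 1)/(φ + 1)`, attained by `m = 2fsT/(D₁ + D₂)`). [folklore] -/
theorem range1_misfit_lower_bound {F D₁ D₂ m : ℝ} (hD₁ : 0 < D₁) (hD₂ : 0 < D₂) (hF : F ≠ 0) :
    |D₂ - D₁| / (D₁ + D₂) ≤ max |m * D₁ / F - 1| |m * D₂ / F - 1| := by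
  set a := m * D₁ / F - 1 with ha
  set b := m * D₂ / F - 1 with hb
  have hcross : D₁ * (1 + b) = D₂ * (1 + a) := by rw [ha, hb]; field_simp; ring
  have h1 := abs_sub_le_of_cross hD₂.le hD₁.le hcross
  have hM : D₁ * |b| + D₂ * |a| ≤ (D₁ + D₂) * max |a| |b| := by
    nlinarith [le_max_left |a| |b|, le_max_right |a| |b|, hD₁, hD₂]
  rw [div_le_iff₀ (by linarith)]
  linarith

/-! ## §4 Range 2: the two-harmonic interpolant — misfit of second order -/

/-- Slope of the two-harmonic interpolant of `fsT/harmD` at `s₁, s₂`: `−8β·fsT/(D₁D₂)`. [folklore] -/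
def interpSlope (Δ tpd tpp c ε s₁ s₂ : ℝ) : ℝ :=
  -8 * scaleBeta Δ tpd tpp c ε * fsT Δ tpd tpp c ε / (harmD Δ tpd tpp c ε s₁ * harmD Δ tpd tpp c ε s₂)

/-- Intercept of the two-harmonic interpolant: `fsT/D₁ − interpSlope·s₁`. [folklore] -/
def interpConst (Δ tpd tpp c ε s₁ s₂ : ℝ) : ℝ := fsT Δ tpd tpp c ε / harmD Δ tpd tpp c ε s₁ - interpSlope Δ tpd tpp c ε s₁ s₂ * s₁

/-- The interpolant matches `fsT/D₁` at `s₁`. [folklore] -/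
theorem interp_at₁ (Δ tpd tpp c ε s₁ s₂ : ℝ) :
    interpConst Δ tpd tpp c ε s₁ s₂ + interpSlope Δ tpd tpp c ε s₁ s₂ * s₁ = fsT Δ tpd tpp c ε / harmD Δ tpd tpp c ε s₁ := by
  unfold interpConst; ring

/-- The interpolant matches `fsT/D₂` at `s₂` (`D₁, D₂ ≠ 0`). [folklore] -/
theorem interp_at₂ {Δ tpd tpp c ε s₁ s₂ : ℝ} (hD₁ : harmD Δ tpd tpp c ε s₁ ≠ 0) (hD₂ : harmD Δ tpd tpp c ε s₂ ≠ 0) :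
    interpConst Δ tpd tpp c ε s₁ s₂ + interpSlope Δ tpd tpp c ε s₁ s₂ * s₂ = fsT Δ tpd tpp c ε / harmD Δ tpd tpp c ε s₂ := by
  unfold interpConst interpSlope harmD at *
  field_simp
  ring

/-- **THE RANGE-2 DEFECT**: for every `s`, `M(s)·harmD(s) − fsT = −64β²·fsT·(s − s₁)(s − s₂)/(D₁D₂)` (`D₁, D₂ ≠ 0`). [folklore] -/
theorem range2_defect_eq {Δ tpd tpp c ε s₁ s₂ : ℝ} (hD₁ : harmD Δ tpd tpp c ε s₁ ≠ 0) (hD₂ : harmD Δ tpd tpp c ε s₂ ≠ 0) (s : ℝ) :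
    (interpConst Δ tpd tpp c ε s₁ s₂ + interpSlope Δ tpd tpp c ε s₁ s₂ * s) * harmD Δ tpd tpp c ε s - fsT Δ tpd tpp c ε =
      -64 * scaleBeta Δ tpd tpp c ε ^ 2 * fsT Δ tpd tpp c ε * (s - s₁) * (s - s₂) / (harmD Δ tpd tpp c ε s₁ * harmD Δ tpd tpp c ε s₂) := by
  unfold interpConst interpSlope harmD at *
  field_simp
  ring

/-- **THE RANGE-2 MISFIT ON THE CONTOUR**: at a contour point with harmonic `s(k)`, the form `(fsQ − cA)·(interpConst + interpSlope·s)` has velocity misfit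
`e(k) = M(s(k))·∂_ε charCubic(k) − 1 = 64β²·(s(k) − s₁)(s₂ − s(k))/(D₁D₂)` (`fsT ≠ 0`, `D₁, D₂ ≠ 0`). [folklore] -/
theorem range2_misfit_on_contour {Δ tpd tpp c x y ε s₁ s₂ : ℝ} (hP : charCubic Δ tpd tpp c x y ε = 0) (hT : fsT Δ tpd tpp c ε ≠ 0)
    (hD₁ : harmD Δ tpd tpp c ε s₁ ≠ 0) (hD₂ : harmD Δ tpd tpp c ε s₂ ≠ 0) :
    (interpConst Δ tpd tpp c ε s₁ s₂ + interpSlope Δ tpd tpp c ε s₁ s₂ * tpHarm x y) * dcharCubic Δ tpd tpp c x y ε - 1 =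
      64 * scaleBeta Δ tpd tpp c ε ^ 2 * (tpHarm x y - s₁) * (s₂ - tpHarm x y) / (harmD Δ tpd tpp c ε s₁ * harmD Δ tpd tpp c ε s₂) := by
  have h := fsT_mul_misfit (interpConst Δ tpd tpp c ε s₁ s₂ + interpSlope Δ tpd tpp c ε s₁ s₂ * tpHarm x y) hP
  rw [range2_defect_eq hD₁ hD₂] at h
  have h' : (interpConst Δ tpd tpp c ε s₁ s₂ + interpSlope Δ tpd tpp c ε s₁ s₂ * tpHarm x y) * dcharCubic Δ tpd tpp c x y ε - 1 =
      (-64 * scaleBeta Δ tpd tpp c ε ^ 2 * fsT Δ tpd tpp c ε * (tpHarm x y - s₁) * (tpHarm x y - s₂) /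
        (harmD Δ tpd tpp c ε s₁ * harmD Δ tpd tpp c ε s₂)) / fsT Δ tpd tpp c ε := by
    rw [eq_div_iff hT, mul_comm]; exact h
  rw [h']
  field_simp
  ring

/-- The range-2 misfit is NON-NEGATIVE between the two matching harmonics (`D₁, D₂ > 0`). [folklore] -/
theorem range2_misfit_nonneg {β D₁ D₂ s₁ s₂ s : ℝ} (hD₁ : 0 < D₁) (hD₂ : 0 < D₂) (h₁ : s₁ ≤ s) (h₂ : s ≤ s₂) :
    0 ≤ 64 * β ^ 2 * (s - s₁) * (s₂ - s) / (D₁ * D₂) := by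
  have : 0 ≤ s - s₁ := sub_nonneg.2 h₁
  have : 0 ≤ s₂ - s := sub_nonneg.2 h₂
  positivity

/-- The range-2 misfit is AT MOST `16β²(s₂ − s₁)²/(D₁D₂)` between the two matching harmonics (maximum at the mid harmonic). [folklore] -/
theorem range2_misfit_le {β D₁ D₂ s₁ s₂ s : ℝ} (hD₁ : 0 < D₁) (hD₂ : 0 < D₂) :
    64 * β ^ 2 * (s - s₁) * (s₂ - s) / (D₁ * D₂) ≤ 16 * β ^ 2 * (s₂ - s₁) ^ 2 / (D₁ * D₂) := by
  apply div_le_div_of_nonneg_right _ (mul_pos hD₁ hD₂).le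
  nlinarith [sq_nonneg (2 * s - s₁ - s₂), sq_nonneg β, mul_nonneg (sq_nonneg β) (sq_nonneg (2 * s - s₁ - s₂))]

/-- THE BOUND IN DENOMINATOR FORM: with `D₂ − D₁ = 8β(s₂ − s₁)`, `16β²(s₂ − s₁)²/(D₁D₂) = (D₂ − D₁)²/(4D₁D₂)`. [folklore] -/
theorem misfitBound_eq {β D₁ D₂ s₁ s₂ : ℝ} (h : D₂ - D₁ = 8 * β * (s₂ - s₁)) :
    16 * β ^ 2 * (s₂ - s₁) ^ 2 / (D₁ * D₂) = (D₂ - D₁) ^ 2 / (4 * (D₁ * D₂)) := by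
  rw [h]; ring

/-- THE BOUND IN ANISOTROPY FORM: `(D₂ − D₁)²/(4D₁D₂) = (φ − 1)²/(4φ)` with `φ = D₂/D₁` (`D₁, D₂ ≠ 0`). [folklore] -/
theorem misfitBound_eq_phi {D₁ D₂ : ℝ} (hD₁ : D₁ ≠ 0) (hD₂ : D₂ ≠ 0) :
    (D₂ - D₁) ^ 2 / (4 * (D₁ * D₂)) = (D₂ / D₁ - 1) ^ 2 / (4 * (D₂ / D₁)) := by
  field_simp

/-- MONOTONICITY OF THE BOUND: `1 ≤ u ≤ v` ⇒ `(u − 1)²/(4u) ≤ (v − 1)²/(4v)` — with the census anisotropy `t_eff(k) ≤ (1 + φ)·t_eff(k′)` of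
router/EMERY-SCALE-POINTS (`D_max/D_min ≤ 1 + φ`) the range-2 ceiling of a typed row is `φ²/(4(1 + φ))`. [folklore] -/
theorem misfitBound_mono {u v : ℝ} (hu : 1 ≤ u) (huv : u ≤ v) : (u - 1) ^ 2 / (4 * u) ≤ (v - 1) ^ 2 / (4 * v) := by
  have hu0 : 0 < u := by linarith
  have hv0 : 0 < v := by linarith
  rw [div_le_div_iff₀ (by linarith) (by linarith)]
  have h1 : 0 ≤ v - u := sub_nonneg.2 huv
  have h2 : 0 ≤ u * v - 1 := by nlinarith
  nlinarith [mul_nonneg h1 h2]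

/-- RANGE 2 BEATS THE RANGE-1 FLOOR whenever `φ < 4`: `0 < D₁ ≤ D₂ < 4D₁` ⇒ `(D₂ − D₁)²/(4D₁D₂) ≤ (D₂ − D₁)/(D₁ + D₂)`, strictly if `D₁ < D₂`. [folklore] -/
theorem range2_bound_lt_range1_bound {D₁ D₂ : ℝ} (hD₁ : 0 < D₁) (h12 : D₁ < D₂) (h4 : D₂ < 4 * D₁) :
    (D₂ - D₁) ^ 2 / (4 * (D₁ * D₂)) < (D₂ - D₁) / (D₁ + D₂) := by
  have hD₂ : 0 < D₂ := by linarith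
  rw [div_lt_div_iff₀ (by positivity) (by positivity)]
  have hpos : 0 < D₂ - D₁ := sub_pos.2 h12
  have key : (D₂ - D₁) * (D₁ + D₂) < 4 * (D₁ * D₂) := by nlinarith
  nlinarith [mul_lt_mul_of_pos_left key hpos]

/-- **THE RANGE-2 FORM IN COSINES**: at `x = (1 − cos k_x)/2`, `y = (1 − cos k_y)/2` and `s = tpHarm x y = (1 − cos k_x cos k_y)/2`,
`(fsQ − cA)·(a + b·s) = K + oneBand5 t t′ t″ t‴ t⁗` with `t = fsT(a + b/4)`, `t′ = −(a + b/2)fsN + (b/8)(4(fsD + fsN) − cA)`, `t″ = b·fsN/4`, `t‴ = −b·fsT/8`,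
`t⁗ = b·fsN/8`, `K = (a + b/2)(4(fsD + fsN) − cA) − (b/2)fsN`. [folklore] -/
theorem range2Form_cos (Δ tpd tpp c ε a b kx ky : ℝ) :
    (fsQ Δ tpd tpp c ((1 - cos kx) / 2) ((1 - cos ky) / 2) ε - cA Δ ε) * (a + b * tpHarm ((1 - cos kx) / 2) ((1 - cos ky) / 2)) =
      ((a + b / 2) * (4 * (fsD Δ tpd c ε + fsN tpd tpp c ε) - cA Δ ε) - b / 2 * fsN tpd tpp c ε)
        + oneBand5 (fsT Δ tpd tpp c ε * (a + b / 4))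
            (-(a + b / 2) * fsN tpd tpp c ε + b / 8 * (4 * (fsD Δ tpd c ε + fsN tpd tpp c ε) - cA Δ ε))
            (b * fsN tpd tpp c ε / 4) (-(b * fsT Δ tpd tpp c ε) / 8) (b * fsN tpd tpp c ε / 8) kx ky := by
  unfold fsQ tpHarm oneBand5 fsT
  rw [cos_two_mul, cos_two_mul]
  ring

/-- RANGE 1 AS THE CASE `b = 0`: `(fsQ − cA)·a = a(4(fsD + fsN) − cA) + oneBand5 (a·fsT) (−a·fsN) 0 0 0` — the `t–t′` form with `t′/t = −fsN/fsT` (the contour's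
`fsRatio`). [folklore] -/
theorem range1Form_cos (Δ tpd tpp c ε a kx ky : ℝ) :
    (fsQ Δ tpd tpp c ((1 - cos kx) / 2) ((1 - cos ky) / 2) ε - cA Δ ε) * a =
      a * (4 * (fsD Δ tpd c ε + fsN tpd tpp c ε) - cA Δ ε) + oneBand5 (a * fsT Δ tpd tpp c ε) (-(a * fsN tpd tpp c ε)) 0 0 0 kx ky := by
  unfold fsQ oneBand5 fsT
  ring

/-- **THE FIXED PROPORTION OF THE GENERATED HOPPINGS**: with `r = −fsN/fsT` (the contour's `t′/t`), `t″ = 2r·t‴` and `t⁗ = t″/2` for EVERY `(a, b)` (`fsT ≠ 0`).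
[folklore] -/
theorem range2_hopping_ratios {Δ tpd tpp c ε : ℝ} (b : ℝ) (hT : fsT Δ tpd tpp c ε ≠ 0) :
    b * fsN tpd tpp c ε / 4 = 2 * (-fsN tpd tpp c ε / fsT Δ tpd tpp c ε) * (-(b * fsT Δ tpd tpp c ε) / 8) ∧
      b * fsN tpd tpp c ε / 8 = (b * fsN tpd tpp c ε / 4) / 2 := by
  constructor
  · field_simp; ring
  · ring

/-! ## §5 Fermi-surface invisibility of the individual longer-range hoppings -/

/-- `(fsQ − cA)²` IS A RANGE-2 DISPERSION: with `C₀ = 4(fsD + fsN) − cA`,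
`(fsQ − cA)² = (C₀² + 4fsT² + 4fsN²) + oneBand5 (2fsT·C₀ + 4fsT·fsN) (−2fsT² − 2C₀·fsN) (−fsT² − 2fsN²) (2fsN·fsT) (−fsN²)`. [folklore] -/
theorem gaugeForm_cos (Δ tpd tpp c ε kx ky : ℝ) :
    (fsQ Δ tpd tpp c ((1 - cos kx) / 2) ((1 - cos ky) / 2) ε - cA Δ ε) ^ 2 =
      ((4 * (fsD Δ tpd c ε + fsN tpd tpp c ε) - cA Δ ε) ^ 2 + 4 * fsT Δ tpd tpp c ε ^ 2 + 4 * fsN tpd tpp c ε ^ 2)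
        + oneBand5 (2 * fsT Δ tpd tpp c ε * (4 * (fsD Δ tpd c ε + fsN tpd tpp c ε) - cA Δ ε) + 4 * fsT Δ tpd tpp c ε * fsN tpd tpp c ε)
            (-2 * fsT Δ tpd tpp c ε ^ 2 - 2 * (4 * (fsD Δ tpd c ε + fsN tpd tpp c ε) - cA Δ ε) * fsN tpd tpp c ε)
            (-fsT Δ tpd tpp c ε ^ 2 - 2 * fsN tpd tpp c ε ^ 2) (2 * fsN tpd tpp c ε * fsT Δ tpd tpp c ε) (-fsN tpd tpp c ε ^ 2) kx ky := by
  unfold fsQ oneBand5 fsT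
  rw [cos_two_mul, cos_two_mul]
  ring

/-- **GAUGE**: adding `γ·(fsQ − cA)²` to a form `(fsQ − cA)·M` gives the form `(fsQ − cA)·(M + γ(fsQ − cA))`, whose multiplier AGREES WITH `M` ON THE CONTOUR —
same contour, same first-order data (`form_eq_relVel_mul_linBand`), different `t′, t″, t‴, t⁗` (`gaugeForm_cos`). [folklore] -/
theorem gauge_multiplier_on_contour {Δ tpd tpp c x y ε : ℝ} (M γ : ℝ) (hP : charCubic Δ tpd tpp c x y ε = 0) :
    (fsQ Δ tpd tpp c x y ε - cA Δ ε) * M + γ * (fsQ Δ tpd tpp c x y ε - cA Δ ε) ^ 2 =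
        (fsQ Δ tpd tpp c x y ε - cA Δ ε) * (M + γ * (fsQ Δ tpd tpp c x y ε - cA Δ ε)) ∧
      (M + γ * (fsQ Δ tpd tpp c x y ε - cA Δ ε)) * dcharCubic Δ tpd tpp c x y ε = M * dcharCubic Δ tpd tpp c x y ε := by
  refine ⟨by ring, ?_⟩
  rw [fsQ_eq_cA_of_contour hP, sub_self, mul_zero, add_zero]

/-! ## §6 The quadrature (one-number) law -/

/-- **QUADRATURE LAW**: for any finite family of contour points `kᵢ` with weights `wᵢ`, `Σ wᵢ/t_eff(kᵢ) = (α·Σ wᵢ + 8β·Σ wᵢ s(kᵢ))/fsT²` (`fsT ≠ 0`). [folklore] -/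
theorem sum_inv_scaleT {ι : Type*} (S : Finset ι) (w x y : ι → ℝ) {Δ tpd tpp c ε : ℝ}
    (hP : ∀ i ∈ S, charCubic Δ tpd tpp c (x i) (y i) ε = 0) (hT : fsT Δ tpd tpp c ε ≠ 0) :
    ∑ i ∈ S, w i * (scaleT Δ tpd tpp c (x i) (y i) ε)⁻¹ =
      (scaleAlpha Δ tpd tpp c ε * ∑ i ∈ S, w i + 8 * scaleBeta Δ tpd tpp c ε * ∑ i ∈ S, w i * tpHarm (x i) (y i)) / fsT Δ tpd tpp c ε ^ 2 := by
  have h : ∀ i ∈ S, w i * (scaleT Δ tpd tpp c (x i) (y i) ε)⁻¹ =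
      (scaleAlpha Δ tpd tpp c ε * w i + 8 * scaleBeta Δ tpd tpp c ε * (w i * tpHarm (x i) (y i))) / fsT Δ tpd tpp c ε ^ 2 := by
    intro i hi
    rw [inv_scaleT_eq_harmonic (hP i hi) hT]
    ring
  rw [Finset.sum_congr rfl h, ← Finset.sum_div, Finset.sum_add_distrib, ← Finset.mul_sum, ← Finset.mul_sum]

/-- **THE ONE-NUMBER LAW**: every weighted HARMONIC MEAN of the velocity-matched `t` over Fermi points (weights summing to `1`) is the harmonic-law scale at the
MEAN HARMONIC `s̄ = Σ wᵢ s(kᵢ)`: `(Σ wᵢ/t_eff(kᵢ))⁻¹ = fsT²/(α + 8β·s̄)`. [folklore] -/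
theorem harmMean_scaleT_eq {ι : Type*} (S : Finset ι) (w x y : ι → ℝ) {Δ tpd tpp c ε : ℝ}
    (hP : ∀ i ∈ S, charCubic Δ tpd tpp c (x i) (y i) ε = 0) (hT : fsT Δ tpd tpp c ε ≠ 0) (hw : ∑ i ∈ S, w i = 1) :
    (∑ i ∈ S, w i * (scaleT Δ tpd tpp c (x i) (y i) ε)⁻¹)⁻¹ =
      fsT Δ tpd tpp c ε ^ 2 / harmD Δ tpd tpp c ε (∑ i ∈ S, w i * tpHarm (x i) (y i)) := by
  rw [sum_inv_scaleT S w x y hP hT, hw, mul_one, inv_div]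
  rfl

end Summit.Ventures.CertifiedManyBodySolver.Downfold.Emery
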